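import Literature.AlgebraicGeometry.ModuliOfAbelianVarieties.SiegelFineModuliFibreTriples         -- ★ `isAdmissibleAt_of_classifyingMap_eq`, `eq_classifyingMap`, `IsAdmissibleAt`
import Literature.AlgebraicGeometry.ModuliOfAbelianVarieties.SiegelAdmissibleClassUniqueTwoReps  -- ★ `siegelShimuraSet_mk_eq_of_isAdmissibleAt₂` (Milne Thm. 6.11 injectivity, two integral reps)
import Literature.AlgebraicGeometry.ModuliOfAbelianVarieties.SiegelAdmissibleAlignReadings       -- ★ `IsAdmissibleAt.rationalMove`
import Literature.AlgebraicGeometry.ModuliOfAbelianVarieties.SiegelShimuraSetPrincipalDissection -- ★ `SiegelShimuraSet.exists_eq_mk_jOfSiegel` (principal representatives), `mk_mul_of_mem`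
import Literature.AlgebraicGeometry.Morphisms.CofanPieceFactorization                          -- ★ `Over.exists_fac_of_isColimit_cofan_of_mem`, `exists_eq_of_isColimit_cofan`, `isColimit_cofan_left`
import Literature.AlgebraicGeometry.Motives.BaseChange                                          -- ★ `AlgPoints.baseChangeEquiv`
import HarnessLib

/-!
# An ADMISSIBLE triple over `Spec ℂ` is classified by the Siegel point of ITS class — at ANY representative `(Z, r)`
# ([Milne 2005] Thm. 6.11 «`ℳ_K/≈ → Sh_K(ℂ)` is a bijection»; [MFK94] App. 7A; [Deligne 1971] 4.16)

Topic `AlgebraicGeometry/ModuliOfAbelianVarieties`, namespace `Literature.AlgebraicGeometry.ModuliOfAbelianVarieties.SiegelFineModuliScheme`.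
THEOREMS ONLY (no definition, no instance, no notation, no named fact, no `sorry`).  Cell `hodgecm-mathlib` (D-0151), P6 «MOD programme»,
crux hLiu418 (stmt-HodgeConjecture-24832, `--supports`, count-neutral), line «L4», (S8) closer `Lines/F0_P6a_StubESHEET.lean`, road (γ′) «SERRE
TENSOR OVER `X`, CLASSIFIED», DEAL #38 «`hε₂` — the point reading of `ε₂` at a marked complex fibre» (LA4-plan (g2) → LA4-p02 (g2)): THIS FILE IS
ITS GENERIC HALF [B].  The uniformisation datum (U) of a Siegel fine moduli scheme `𝓜` (the pieces `S_c ↪ 𝓜_ℂ`, `unif_c : 𝔥_g → S_c(ℂ)`, the principal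
representatives `r_c = diag(1, u_c·1)`, the Shimura-set bijection `pts` with `pts (ι_c (unif_c W)) = [J(W), r_c]`, and the JUNCTION «(U3∃)+(U3-D3) at the
principal representatives») is taken BY VALUE, binder for binder the fields `Sc ιc unif u rep pts isColimit_ιc unif_surj rep_spec pts_unif junction` of the
E-line chart `AuxChartGS` (`Cruxes/HLiu418/Lines/F0_P6a_PELWitnessEDefs.lean`) — so the head instantiates at `C.…` with no glue.

THE POINT.  The junction classifies admissible triples only at the PRINCIPAL representatives `(W, r_c)`; the sheet line՚s twisted fibre
`(A_x ⊗ 𝔞⁻¹, λ′, η′)` is admissible at `(Z, r′·ũ_V(1, z))`, an ARBITRARY representative of its class.  Bridge: the classifying point `p` of `P′` lies on a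
piece, `p = ι_c (unif_c W)` (the legs of a colimit cofan cover, `unif_c` is onto); the junction՚s (U3∃) triple at `p` has the same classifying map as `P′`, so
`P′` is admissible at `(W, r_c)` too (★ `isAdmissibleAt_of_classifyingMap_eq`: admissibility is a property of the classifying point); the class `[J(Z), r]` has
a principal representative `[J(Z₁), r_{c₁}]` (★ `SiegelShimuraSet.exists_eq_mk_jOfSiegel`), and the rational mover of the two carries the admissibility at
`(Z, r)` to `(Z₁, r_{c₁}·k)`, `k ∈ K_δ(N)` (★ `IsAdmissibleAt.rationalMove`); now BOTH representatives are integral and Milne՚s injectivity for one triple read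
at two integral representatives (★ `siegelShimuraSet_mk_eq_of_isAdmissibleAt₂`) gives `[J(W), r_c] = [J(Z₁), r_{c₁}k] = [J(Z), r]`; finally `pts p = [J(W), r_c]`.

* §1 `exists_piece_unif_eq_of_isColimit` — every complex point of `𝓜_ℂ` is `ι_c (unif_c W)` for some piece `c` and `W ∈ 𝔥_g`;
* §2 `isAdmissibleAt_principalRep_of_eq_map_unif` — a triple whose classifying point is `ι_c (unif_c W)` is admissible at `(W, r_c)`;
* §3 **`pts_classifyingMap_eq_mk_of_isAdmissibleAt`** — THE HEAD: `IsAdmissibleAt hδ r Z hZ P′ → pts (bce (classifyingMap P′)) = [J(Z), r·K_δ(N)]`,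
  and `map_unif_eq_classifyingMap_of_isAdmissibleAt` (the junction՚s (U3-D3) conclusion at an arbitrary representative, through a principal one).
* §4 (ED. 2) `pts_comp_classifyingMap_eq_mk_of_isAdmissibleAt`, `map_unif_eq_comp_classifyingMap_of_isAdmissibleAt` — the same for the classifying map of
  a FAMILY over a base `T`, read at a complex point `x` whose fibre (any pull-back `Pₓ`, relation form) is admissible (★ `classifyingMap_comp`);
  (ED. 3) `pts_comp_classifyingMap_eq_mk_of_mover` — the same read at a MOVED representative `[J, s]` (`q_ℝ⁻¹ J q_ℝ = J(Z)`, `q_𝔸 • rK = sK`).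

## References
* [Milne2005ShimuraVarieties] J. S. Milne, *Introduction to Shimura varieties* (2005; rev. 2017), §5 Lemma 5.13 p. 57; §6 Thm. 6.11 pp. 74–75 and (63) p. 116.
* [MumfordFogartyKirwan1994] D. Mumford, J. Fogarty, F. Kirwan, *Geometric Invariant Theory* (3rd ed. 1994), Ch. 7 §2 Def. 7.2–7.3 (p. 129), App. 7A pp. 234–235.
* [Deligne1971TravauxShimura] P. Deligne, *Travaux de Shimura* (1971), 4.11–4.12 pp. 148–149, Exemple 4.16 p. 150.
* [GortzWedhorn2020] U. Görtz, T. Wedhorn, *Algebraic Geometry I* (2nd ed. 2020), §(3.5) Prop. 3.10 and Example 3.11 (p. 73).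
-/

set_option autoImplicit false

noncomputable section

open CategoryTheory CategoryTheory.Limits AlgebraicGeometry Matrix
open Literature.AlgebraicGeometry.Motives (SchemeOver ComplexPoints AlgPoints specOver)
open Literature.AlgebraicGeometry.AbelianSchemes (PolarizedAbelianSchemeWithLevel)
open Literature.NumberTheory.Automorphic (siegelUpperHalfSpace)
open Literature.AlgebraicGeometry.Morphisms

namespace Literature.AlgebraicGeometry.ModuliOfAbelianVarieties

namespace SiegelFineModuliScheme

open SiegelModuli (jOfSiegel jOfSiegel_mem_C0)

variable {g N : ℕ} {δ : Fin g → ℕ}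

/-! ### §1 Every complex point of `𝓜_ℂ` lies on a piece: `p = ι_c (unif_c W)` -/

/-- **Every complex point of the apex of a colimit cofan of uniformised pieces is `ι_c (unif_c W)`**: the underlying point lies in the image of
some leg (the legs of a coproduct cover, ★ `exists_eq_of_isColimit_cofan`), the `ℂ`-point factors through that leg (★ `Over.exists_fac_of_isColimit_cofan_of_mem`,
`Spec ℂ` is connected), and `unif_c` is onto `S_c(ℂ)`. [cite: GortzWedhorn2020, §(3.5) Proposition 3.10 and Example 3.11 (p. 73)]
[cite: MumfordFogartyKirwan1994, Appendix to Ch. 7 §A pp. 234–235] -/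
theorem exists_piece_unif_eq_of_isColimit {κ : Type} (M : SchemeOver ℂ) (Sc : κ → SchemeOver ℂ) (ιc : ∀ c, Sc c ⟶ M)
    (hcol : IsColimit (Cofan.mk M ιc)) (unif : ∀ c : κ, Matrix (Fin g) (Fin g) ℂ → ComplexPoints (Sc c))
    (unif_surj : ∀ c, Set.SurjOn (unif c) (siegelUpperHalfSpace g) Set.univ) (p : ComplexPoints M) :
    ∃ (c : κ) (W : Matrix (Fin g) (Fin g) ℂ), W ∈ siegelUpperHalfSpace g ∧ AlgPoints.map (ιc c) (unif c W) = p := by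
  obtain ⟨hcolL⟩ := isColimit_cofan_left hcol
  haveI : PreconnectedSpace (specOver ℂ ℂ).left :=
    inferInstanceAs (PreconnectedSpace ↥(Spec (CommRingCat.of ℂ)))
  -- the underlying point of `p` lies on some leg
  obtain ⟨c, y, hy⟩ := exists_eq_of_isColimit_cofan hcolL (p.left.base (IsLocalRing.closedPoint ℂ))
  -- the `ℂ`-point factors through that leg
  obtain ⟨pc, hpc⟩ := exists_fac_of_isColimit_cofan_of_mem hcol p (IsLocalRing.closedPoint ℂ) c ⟨y, hy⟩
  -- `unif_c` is onto
  obtain ⟨W, hW, hWp⟩ := unif_surj c (Set.mem_univ pc)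
  exact ⟨c, W, hW, by rw [hWp, AlgPoints.map_apply]; exact hpc⟩

/-! ### §2 A triple classified by a uniformised point is admissible at the principal representative there -/

section Junction

variable (hδ : IsPolarizationType δ) (𝓜 : SiegelFineModuliScheme g N δ)
  (Sc : (ZMod N)ˣ → SchemeOver ℂ) (ιc : ∀ c, Sc c ⟶ (Literature.AlgebraicGeometry.Motives.baseChange ℚ ℂ).obj 𝓜.M)
  (unif : ∀ c : (ZMod N)ˣ, Matrix (Fin g) (Fin g) ℂ → ComplexPoints (Sc c))
  (u : (ZMod N)ˣ → finAdeleQˣ) (rep : (ZMod N)ˣ → ↥(gspFinAdelic δ))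
  (pts : ComplexPoints ((Literature.AlgebraicGeometry.Motives.baseChange ℚ ℂ).obj 𝓜.M) ≃ SiegelShimuraSet δ (principalLevelSubgroup δ N))
  (rep_spec : ∀ c, (∀ w, Valued.v ((u c : finAdeleQ) w) = 1) ∧ (u c : finAdeleQ) - ((c : ZMod N).val : ℕ) ∈ levelIdeal N ∧
    rep c ∈ principalLevelSubgroup δ 1 ∧
      IsMultiplier (typeFormOver δ finAdeleQ) (rep c : GL (Fin g ⊕ Fin g) finAdeleQ) (u c) ∧
        ((rep c : GL (Fin g ⊕ Fin g) finAdeleQ) : Matrix (Fin g ⊕ Fin g) (Fin g ⊕ Fin g) finAdeleQ) =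
          Matrix.fromBlocks 1 0 0 ((u c : finAdeleQ) • (1 : Matrix (Fin g) (Fin g) finAdeleQ)))
  (pts_unif : ∀ (c : (ZMod N)ˣ) (W : Matrix (Fin g) (Fin g) ℂ) (hW : W ∈ siegelUpperHalfSpace g),
    pts (AlgPoints.map (ιc c) (unif c W)) =
      SiegelShimuraSet.mk δ (principalLevelSubgroup δ N)
        ⟨SiegelModuli.jOfSiegel δ W, C0_subset_C0pm δ (SiegelModuli.jOfSiegel_mem_C0 hδ.1 hW)⟩ (rep c))
  (junction : ∀ (c : (ZMod N)ˣ) (u' : finAdeleQˣ) (r : ↥(gspFinAdelic δ)),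
    (∀ w, Valued.v ((u' : finAdeleQ) w) = 1) →
    (u' : finAdeleQ) - ((c : ZMod N).val : ℕ) ∈ levelIdeal N →
    r ∈ principalLevelSubgroup δ 1 →
    IsMultiplier (typeFormOver δ finAdeleQ) (r : GL (Fin g ⊕ Fin g) finAdeleQ) u' →
    ((r : GL (Fin g ⊕ Fin g) finAdeleQ) : Matrix (Fin g ⊕ Fin g) (Fin g ⊕ Fin g) finAdeleQ) =
      Matrix.fromBlocks 1 0 0 ((u' : finAdeleQ) • (1 : Matrix (Fin g) (Fin g) finAdeleQ)) →
    ∀ (W : Matrix (Fin g) (Fin g) ℂ) (hW : W ∈ siegelUpperHalfSpace g),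
      haveI : IsLocallyNoetherian (specOver ℚ ℂ).left := inferInstanceAs (IsLocallyNoetherian (Spec (CommRingCat.of ℂ)))
      (∃ (P' : PolarizedAbelianSchemeWithLevel g N δ (specOver ℚ ℂ).left)
          (G : P'.A.X.left ⟶ 𝓜.univ.A.X.left) (Ĝ : P'.D.hat.X.left ⟶ 𝓜.univ.D.hat.X.left),
          P'.IsBaseChangeVia 𝓜.univ ((AlgPoints.baseChangeEquiv (algebraMap ℚ ℂ) 𝓜.M).symm (AlgPoints.map (ιc c) (unif c W))).left G Ĝ ∧
          IsAdmissibleAt hδ r W hW P') ∧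
      (∀ (P' : PolarizedAbelianSchemeWithLevel g N δ (specOver ℚ ℂ).left), IsAdmissibleAt hδ r W hW P' →
          AlgPoints.map (ιc c) (unif c W) = AlgPoints.baseChangeEquiv (algebraMap ℚ ℂ) 𝓜.M (𝓜.classifyingMap (specOver ℚ ℂ) P')))

include rep_spec junction in
/-- **A triple over `Spec ℂ` whose classifying point is the uniformised point `ι_c (unif_c W)` is admissible at `(W, r_c)`**: the junction՚s (U3∃) triple at that
point is admissible there and is a base change of the universal triple along the SAME point, hence has the same classifying map (★ `eq_classifyingMap`),
and admissibility is a property of the classifying point (★ `isAdmissibleAt_of_classifyingMap_eq`).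
[cite: Milne2005ShimuraVarieties, §6 Thm. 6.11 pp. 74–75] [cite: MumfordFogartyKirwan1994, Ch. 7 §2 Definition 7.3 (p. 129)] -/
theorem isAdmissibleAt_principalRep_of_eq_map_unif (P' : PolarizedAbelianSchemeWithLevel g N δ (specOver ℚ ℂ).left)
    (c : (ZMod N)ˣ) (W : Matrix (Fin g) (Fin g) ℂ) (hW : W ∈ siegelUpperHalfSpace g)
    (hp : haveI : IsLocallyNoetherian (specOver ℚ ℂ).left := inferInstanceAs (IsLocallyNoetherian (Spec (CommRingCat.of ℂ)))
      AlgPoints.baseChangeEquiv (algebraMap ℚ ℂ) 𝓜.M (𝓜.classifyingMap (specOver ℚ ℂ) P') = AlgPoints.map (ιc c) (unif c W)) :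
    IsAdmissibleAt hδ (rep c) W hW P' := by
  haveI : IsLocallyNoetherian (specOver ℚ ℂ).left := inferInstanceAs (IsLocallyNoetherian (Spec (CommRingCat.of ℂ)))
  obtain ⟨hu1, hu2, hr1, hmult, hblock⟩ := rep_spec c
  obtain ⟨⟨P₀, G, Ĝ, hBC, h₀⟩, -⟩ := junction c (u c) (rep c) hu1 hu2 hr1 hmult hblock W hW
  -- the point of the junction IS the classifying map of `P'`
  have hpt : (AlgPoints.baseChangeEquiv (algebraMap ℚ ℂ) 𝓜.M).symm (AlgPoints.map (ιc c) (unif c W)) = 𝓜.classifyingMap (specOver ℚ ℂ) P' :=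
    (Equiv.symm_apply_eq _).2 hp.symm
  have hBC' : P₀.IsBaseChangeVia 𝓜.univ (𝓜.classifyingMap (specOver ℚ ℂ) P').left G Ĝ := by
    convert hBC using 3
    exact hpt.symm
  -- so `P₀` and `P'` have the same classifying map
  have hcls : 𝓜.classifyingMap (specOver ℚ ℂ) P' = 𝓜.classifyingMap (specOver ℚ ℂ) P₀ :=
    𝓜.eq_classifyingMap (specOver ℚ ℂ) P₀ (𝓜.classifyingMap (specOver ℚ ℂ) P') ⟨G, Ĝ, hBC'⟩
  exact 𝓜.isAdmissibleAt_of_classifyingMap_eq hδ P₀ P' h₀ hcls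

/-! ### §3 THE HEAD: admissible at `(Z, r)` ⇒ classified by `pts⁻¹[J(Z), r]` -/

include rep_spec pts_unif junction in
/-- **AN ADMISSIBLE TRIPLE IS CLASSIFIED BY THE SIEGEL POINT OF ITS CLASS, AT ANY REPRESENTATIVE** ([Milne2005ShimuraVarieties] Thm. 6.11): for `0 < g`, `δ` a
polarisation type, `N ≥ 3`, the uniformisation datum (U) of `𝓜` BY VALUE, and a triple `P′` over `Spec ℂ` admissible at `(Z, r)` — `Z ∈ 𝔥_g`, `r ∈ GSp_δ(𝔸_f)`
ARBITRARY (not a principal representative, not even integral) — the Shimura-set shadow of its classifying point is `[J(Z), r·K_δ(N)]`.  Road in the module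
docstring: the classifying point lies on a piece (§1), so `P′` is admissible at that piece՚s `(W, r_c)` (§2); the class `[J(Z), r]` has a principal representative
`[J(Z₁), r_{c₁}]` (★ `exists_eq_mk_jOfSiegel`) and the rational mover carries admissibility to `(Z₁, r_{c₁}k)` with `k ∈ K_δ(N)` (★ `rationalMove`); Milne՚s
injectivity at two INTEGRAL representatives (★ `siegelShimuraSet_mk_eq_of_isAdmissibleAt₂`) and `pts (ι_c (unif_c W)) = [J(W), r_c]` finish.
[cite: Milne2005ShimuraVarieties, §6 Thm. 6.11 pp. 74–75, Lemma 5.13 p. 57] [cite: Deligne1971TravauxShimura, 4.16 p. 150] [cite: MumfordFogartyKirwan1994, Appendix to Ch. 7 §A pp. 234–235] -/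
theorem pts_classifyingMap_eq_mk_of_isAdmissibleAt (hg : 0 < g) (hN : 3 ≤ N)
    (hcol : IsColimit (Cofan.mk ((Literature.AlgebraicGeometry.Motives.baseChange ℚ ℂ).obj 𝓜.M) ιc))
    (unif_surj : ∀ c, Set.SurjOn (unif c) (siegelUpperHalfSpace g) Set.univ)
    (P' : PolarizedAbelianSchemeWithLevel g N δ (specOver ℚ ℂ).left)
    {Z : Matrix (Fin g) (Fin g) ℂ} {hZ : Z ∈ siegelUpperHalfSpace g} {r : ↥(gspFinAdelic δ)} (h : IsAdmissibleAt hδ r Z hZ P') :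
    haveI : IsLocallyNoetherian (specOver ℚ ℂ).left := inferInstanceAs (IsLocallyNoetherian (Spec (CommRingCat.of ℂ)))
    pts (AlgPoints.baseChangeEquiv (algebraMap ℚ ℂ) 𝓜.M (𝓜.classifyingMap (specOver ℚ ℂ) P')) =
      SiegelShimuraSet.mk δ (principalLevelSubgroup δ N) ⟨jOfSiegel δ Z, SiegelComplexRecordSystem.jOfSiegel_mem_C0pm hδ.1 hZ⟩ r := by
  haveI : IsLocallyNoetherian (specOver ℚ ℂ).left := inferInstanceAs (IsLocallyNoetherian (Spec (CommRingCat.of ℂ)))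
  have hN0 : N ≠ 0 := by omega
  -- §1 the classifying point lies on a piece
  obtain ⟨c, W, hW, hp⟩ := exists_piece_unif_eq_of_isColimit _ Sc ιc hcol unif unif_surj
    (AlgPoints.baseChangeEquiv (algebraMap ℚ ℂ) 𝓜.M (𝓜.classifyingMap (specOver ℚ ℂ) P'))
  -- §2 so `P'` is admissible at `(W, r_c)`
  have hW' : IsAdmissibleAt hδ (rep c) W hW P' :=
    isAdmissibleAt_principalRep_of_eq_map_unif hδ 𝓜 Sc ιc unif u rep rep_spec junction P' c W hW hp.symm
  -- the class `[J(Z), r]` has a principal representative `[J(Z₁), r_{c₁}]`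
  obtain ⟨c₁, Z₁, hcls⟩ := SiegelShimuraSet.exists_eq_mk_jOfSiegel hδ hN0 (fun c => (rep_spec c).1) (fun c => (rep_spec c).2.1)
    (fun c => (rep_spec c).2.2.2.1)
    (SiegelShimuraSet.mk δ (principalLevelSubgroup δ N) ⟨jOfSiegel δ Z, SiegelComplexRecordSystem.jOfSiegel_mem_C0pm hδ.1 hZ⟩ r)
  -- its rational mover `γ`: `γ • J(Z₁) = J(Z)`, `γ̂ r_{c₁} K = r K`
  obtain ⟨γ, hγJ, hγr⟩ := (SiegelShimuraSet.mk_eq_mk_iff δ (principalLevelSubgroup δ N) _ _ _ _).1 hcls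
  rw [MulAction.Quotient.smul_mk, smul_eq_mul, QuotientGroup.eq] at hγr
  -- `k := (γ̂ r_{c₁})⁻¹ r ∈ K_δ(N)`, so `γ̂⁻¹ r = r_{c₁} k`
  set k : ↥(gspFinAdelic δ) := (gspRationalToFinAdelic δ γ * rep c₁)⁻¹ * r with hk
  have hk1 : rep c₁ * k ∈ principalLevelSubgroup δ 1 :=
    mul_mem (rep_spec c₁).2.2.1 (principalLevelSubgroup_anti δ (one_dvd N) hγr)
  have hmove : (gspRationalToFinAdelic δ γ⁻¹ : ↥(gspFinAdelic δ)) * r = rep c₁ * k := by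
    rw [hk, map_inv]; group
  have hJ : conjAct δ (gspRationalToReal δ γ⁻¹) ⟨jOfSiegel δ Z, SiegelComplexRecordSystem.jOfSiegel_mem_C0pm hδ.1 hZ⟩ =
      ⟨jOfSiegel δ (Z₁ : Matrix (Fin g) (Fin g) ℂ), SiegelComplexRecordSystem.jOfSiegel_mem_C0pm hδ.1 Z₁.2⟩ := by
    have h1 : conjAct δ (gspRationalToReal δ γ⁻¹) (conjAct δ (gspRationalToReal δ γ)
        ⟨jOfSiegel δ (Z₁ : Matrix (Fin g) (Fin g) ℂ), jOfSiegel_coe_mem_C0pm hδ.1 Z₁⟩) =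
        ⟨jOfSiegel δ (Z₁ : Matrix (Fin g) (Fin g) ℂ), jOfSiegel_coe_mem_C0pm hδ.1 Z₁⟩ := by
      rw [← conjAct_mul, ← map_mul, inv_mul_cancel, map_one, conjAct_one]
    rw [hγJ] at h1
    exact h1
  -- the admissibility at `(Z, r)` moves to `(Z₁, r_{c₁} k)` — an INTEGRAL representative
  have h₁ : IsAdmissibleAt hδ (rep c₁ * k) (Z₁ : Matrix (Fin g) (Fin g) ℂ) Z₁.2 P' := h.rationalMove γ⁻¹ hJ hmove
  -- Milne՚s injectivity: one triple read at two integral representatives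
  have heq := siegelShimuraSet_mk_eq_of_isAdmissibleAt₂ hg hδ hN (rep_spec c).2.2.1 hk1 hW Z₁.2 P' hW' h₁
  -- assemble: `pts p = [J(W), r_c] = [J(Z₁), r_{c₁} k] = [J(Z₁), r_{c₁}] = [J(Z), r]`
  have key : pts (AlgPoints.map (ιc c) (unif c W)) =
      SiegelShimuraSet.mk δ (principalLevelSubgroup δ N) ⟨jOfSiegel δ Z, SiegelComplexRecordSystem.jOfSiegel_mem_C0pm hδ.1 hZ⟩ r := by
    rw [pts_unif c W hW, hcls]
    exact heq.trans (SiegelShimuraSet.mk_mul_of_mem δ (principalLevelSubgroup δ N) _ (rep c₁) hγr)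
  exact (congrArg pts hp.symm).trans key

include rep_spec pts_unif junction in
/-- **The junction՚s (U3-D3) conclusion at an ARBITRARY representative**: if `P′` is admissible at `(Z, r)` and `ι_c (unif_c W)` is any uniformised point with
`[J(W), r_c] = [J(Z), r]`, then `ι_c (unif_c W)` IS the classifying point of `P′`. [cite: Milne2005ShimuraVarieties, §6 Thm. 6.11 pp. 74–75]
[cite: MumfordFogartyKirwan1994, Appendix to Ch. 7 §A pp. 234–235] -/
theorem map_unif_eq_classifyingMap_of_isAdmissibleAt (hg : 0 < g) (hN : 3 ≤ N)
    (hcol : IsColimit (Cofan.mk ((Literature.AlgebraicGeometry.Motives.baseChange ℚ ℂ).obj 𝓜.M) ιc))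
    (unif_surj : ∀ c, Set.SurjOn (unif c) (siegelUpperHalfSpace g) Set.univ)
    (P' : PolarizedAbelianSchemeWithLevel g N δ (specOver ℚ ℂ).left)
    {Z : Matrix (Fin g) (Fin g) ℂ} {hZ : Z ∈ siegelUpperHalfSpace g} {r : ↥(gspFinAdelic δ)} (h : IsAdmissibleAt hδ r Z hZ P')
    (c : (ZMod N)ˣ) (W : Matrix (Fin g) (Fin g) ℂ) (hW : W ∈ siegelUpperHalfSpace g)
    (hclass : SiegelShimuraSet.mk δ (principalLevelSubgroup δ N)
        ⟨SiegelModuli.jOfSiegel δ W, C0_subset_C0pm δ (SiegelModuli.jOfSiegel_mem_C0 hδ.1 hW)⟩ (rep c) =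
      SiegelShimuraSet.mk δ (principalLevelSubgroup δ N) ⟨jOfSiegel δ Z, SiegelComplexRecordSystem.jOfSiegel_mem_C0pm hδ.1 hZ⟩ r) :
    haveI : IsLocallyNoetherian (specOver ℚ ℂ).left := inferInstanceAs (IsLocallyNoetherian (Spec (CommRingCat.of ℂ)))
    AlgPoints.map (ιc c) (unif c W) = AlgPoints.baseChangeEquiv (algebraMap ℚ ℂ) 𝓜.M (𝓜.classifyingMap (specOver ℚ ℂ) P') := by
  haveI : IsLocallyNoetherian (specOver ℚ ℂ).left := inferInstanceAs (IsLocallyNoetherian (Spec (CommRingCat.of ℂ)))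
  apply pts.injective
  rw [pts_unif c W hW, hclass]
  exact (pts_classifyingMap_eq_mk_of_isAdmissibleAt hδ 𝓜 Sc ιc unif u rep pts rep_spec pts_unif junction hg hN hcol unif_surj P' h).symm

end Junction

/-! ### §4 (ED. 2) The same read at a complex point of a BASE: `pts (x ≫ classifyingMap_T P) = [J(Z), r]` -/

section AtPoint

variable (hδ : IsPolarizationType δ) (𝓜 : SiegelFineModuliScheme g N δ)
  (Sc : (ZMod N)ˣ → SchemeOver ℂ) (ιc : ∀ c, Sc c ⟶ (Literature.AlgebraicGeometry.Motives.baseChange ℚ ℂ).obj 𝓜.M)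
  (unif : ∀ c : (ZMod N)ˣ, Matrix (Fin g) (Fin g) ℂ → ComplexPoints (Sc c))
  (u : (ZMod N)ˣ → finAdeleQˣ) (rep : (ZMod N)ˣ → ↥(gspFinAdelic δ))
  (pts : ComplexPoints ((Literature.AlgebraicGeometry.Motives.baseChange ℚ ℂ).obj 𝓜.M) ≃ SiegelShimuraSet δ (principalLevelSubgroup δ N))
  (rep_spec : ∀ c, (∀ w, Valued.v ((u c : finAdeleQ) w) = 1) ∧ (u c : finAdeleQ) - ((c : ZMod N).val : ℕ) ∈ levelIdeal N ∧
    rep c ∈ principalLevelSubgroup δ 1 ∧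
      IsMultiplier (typeFormOver δ finAdeleQ) (rep c : GL (Fin g ⊕ Fin g) finAdeleQ) (u c) ∧
        ((rep c : GL (Fin g ⊕ Fin g) finAdeleQ) : Matrix (Fin g ⊕ Fin g) (Fin g ⊕ Fin g) finAdeleQ) =
          Matrix.fromBlocks 1 0 0 ((u c : finAdeleQ) • (1 : Matrix (Fin g) (Fin g) finAdeleQ)))
  (pts_unif : ∀ (c : (ZMod N)ˣ) (W : Matrix (Fin g) (Fin g) ℂ) (hW : W ∈ siegelUpperHalfSpace g),
    pts (AlgPoints.map (ιc c) (unif c W)) =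
      SiegelShimuraSet.mk δ (principalLevelSubgroup δ N)
        ⟨SiegelModuli.jOfSiegel δ W, C0_subset_C0pm δ (SiegelModuli.jOfSiegel_mem_C0 hδ.1 hW)⟩ (rep c))
  (junction : ∀ (c : (ZMod N)ˣ) (u' : finAdeleQˣ) (r : ↥(gspFinAdelic δ)),
    (∀ w, Valued.v ((u' : finAdeleQ) w) = 1) →
    (u' : finAdeleQ) - ((c : ZMod N).val : ℕ) ∈ levelIdeal N →
    r ∈ principalLevelSubgroup δ 1 →
    IsMultiplier (typeFormOver δ finAdeleQ) (r : GL (Fin g ⊕ Fin g) finAdeleQ) u' →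
    ((r : GL (Fin g ⊕ Fin g) finAdeleQ) : Matrix (Fin g ⊕ Fin g) (Fin g ⊕ Fin g) finAdeleQ) =
      Matrix.fromBlocks 1 0 0 ((u' : finAdeleQ) • (1 : Matrix (Fin g) (Fin g) finAdeleQ)) →
    ∀ (W : Matrix (Fin g) (Fin g) ℂ) (hW : W ∈ siegelUpperHalfSpace g),
      haveI : IsLocallyNoetherian (specOver ℚ ℂ).left := inferInstanceAs (IsLocallyNoetherian (Spec (CommRingCat.of ℂ)))
      (∃ (P' : PolarizedAbelianSchemeWithLevel g N δ (specOver ℚ ℂ).left)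
          (G : P'.A.X.left ⟶ 𝓜.univ.A.X.left) (Ĝ : P'.D.hat.X.left ⟶ 𝓜.univ.D.hat.X.left),
          P'.IsBaseChangeVia 𝓜.univ ((AlgPoints.baseChangeEquiv (algebraMap ℚ ℂ) 𝓜.M).symm (AlgPoints.map (ιc c) (unif c W))).left G Ĝ ∧
          IsAdmissibleAt hδ r W hW P') ∧
      (∀ (P' : PolarizedAbelianSchemeWithLevel g N δ (specOver ℚ ℂ).left), IsAdmissibleAt hδ r W hW P' →
          AlgPoints.map (ιc c) (unif c W) = AlgPoints.baseChangeEquiv (algebraMap ℚ ℂ) 𝓜.M (𝓜.classifyingMap (specOver ℚ ℂ) P')))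

include rep_spec pts_unif junction in
/-- **THE CLASSIFYING MAP OF A FAMILY, READ AT A COMPLEX POINT WHERE THE FIBRE IS ADMISSIBLE** (ED. 2; the `ε₂`-point-reading shape of the
sheet line): for a triple `P` over a locally Noetherian `ℚ`-scheme `T`, a complex point `x : Spec ℂ → T` and ANY pull-back `Pₓ` of `P` along `x`
(relation form `IsBaseChangeVia`) admissible at `(Z, r)` — `r` arbitrary — the complex point `x ≫ φ` of `𝓜`, `φ := classifyingMap_T P`, has Shimura-set
shadow `[J(Z), r·K_δ(N)]` (★ `classifyingMap_comp` + §3). [cite: MumfordFogartyKirwan1994, Ch. 7 §2 Definitions 7.2–7.3 (p. 129)]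
[cite: Milne2005ShimuraVarieties, §6 Thm. 6.11 pp. 74–75] -/
theorem pts_comp_classifyingMap_eq_mk_of_isAdmissibleAt (hg : 0 < g) (hN : 3 ≤ N)
    (hcol : IsColimit (Cofan.mk ((Literature.AlgebraicGeometry.Motives.baseChange ℚ ℂ).obj 𝓜.M) ιc))
    (unif_surj : ∀ c, Set.SurjOn (unif c) (siegelUpperHalfSpace g) Set.univ)
    {T : SchemeOver ℚ} [IsLocallyNoetherian T.left] (P : PolarizedAbelianSchemeWithLevel g N δ T.left) (x : specOver ℚ ℂ ⟶ T)
    (Pₓ : PolarizedAbelianSchemeWithLevel g N δ (specOver ℚ ℂ).left) {G : Pₓ.A.X.left ⟶ P.A.X.left} {Ĝ : Pₓ.D.hat.X.left ⟶ P.D.hat.X.left}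
    (hx : Pₓ.IsBaseChangeVia P x.left G Ĝ)
    {Z : Matrix (Fin g) (Fin g) ℂ} {hZ : Z ∈ siegelUpperHalfSpace g} {r : ↥(gspFinAdelic δ)} (h : IsAdmissibleAt hδ r Z hZ Pₓ) :
    pts (AlgPoints.baseChangeEquiv (algebraMap ℚ ℂ) 𝓜.M (x ≫ 𝓜.classifyingMap T P)) =
      SiegelShimuraSet.mk δ (principalLevelSubgroup δ N) ⟨jOfSiegel δ Z, SiegelComplexRecordSystem.jOfSiegel_mem_C0pm hδ.1 hZ⟩ r := by
  haveI : IsLocallyNoetherian (specOver ℚ ℂ).left := inferInstanceAs (IsLocallyNoetherian (Spec (CommRingCat.of ℂ)))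
  rw [𝓜.classifyingMap_comp x P Pₓ hx]
  exact pts_classifyingMap_eq_mk_of_isAdmissibleAt hδ 𝓜 Sc ιc unif u rep pts rep_spec pts_unif junction hg hN hcol unif_surj Pₓ h

include rep_spec pts_unif junction in
/-- **… and the uniformised-point form** (ED. 2): under the same hypotheses, any uniformised point `ι_c (unif_c W)` of the class `[J(Z), r]` IS the point
`x ≫ classifyingMap_T P`. [cite: MumfordFogartyKirwan1994, Ch. 7 §2 Definitions 7.2–7.3 (p. 129)] [cite: Milne2005ShimuraVarieties, §6 Thm. 6.11 pp. 74–75] -/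
theorem map_unif_eq_comp_classifyingMap_of_isAdmissibleAt (hg : 0 < g) (hN : 3 ≤ N)
    (hcol : IsColimit (Cofan.mk ((Literature.AlgebraicGeometry.Motives.baseChange ℚ ℂ).obj 𝓜.M) ιc))
    (unif_surj : ∀ c, Set.SurjOn (unif c) (siegelUpperHalfSpace g) Set.univ)
    {T : SchemeOver ℚ} [IsLocallyNoetherian T.left] (P : PolarizedAbelianSchemeWithLevel g N δ T.left) (x : specOver ℚ ℂ ⟶ T)
    (Pₓ : PolarizedAbelianSchemeWithLevel g N δ (specOver ℚ ℂ).left) {G : Pₓ.A.X.left ⟶ P.A.X.left} {Ĝ : Pₓ.D.hat.X.left ⟶ P.D.hat.X.left}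
    (hx : Pₓ.IsBaseChangeVia P x.left G Ĝ)
    {Z : Matrix (Fin g) (Fin g) ℂ} {hZ : Z ∈ siegelUpperHalfSpace g} {r : ↥(gspFinAdelic δ)} (h : IsAdmissibleAt hδ r Z hZ Pₓ)
    (c : (ZMod N)ˣ) (W : Matrix (Fin g) (Fin g) ℂ) (hW : W ∈ siegelUpperHalfSpace g)
    (hclass : SiegelShimuraSet.mk δ (principalLevelSubgroup δ N)
        ⟨SiegelModuli.jOfSiegel δ W, C0_subset_C0pm δ (SiegelModuli.jOfSiegel_mem_C0 hδ.1 hW)⟩ (rep c) =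
      SiegelShimuraSet.mk δ (principalLevelSubgroup δ N) ⟨jOfSiegel δ Z, SiegelComplexRecordSystem.jOfSiegel_mem_C0pm hδ.1 hZ⟩ r) :
    AlgPoints.map (ιc c) (unif c W) = AlgPoints.baseChangeEquiv (algebraMap ℚ ℂ) 𝓜.M (x ≫ 𝓜.classifyingMap T P) := by
  haveI : IsLocallyNoetherian (specOver ℚ ℂ).left := inferInstanceAs (IsLocallyNoetherian (Spec (CommRingCat.of ℂ)))
  rw [𝓜.classifyingMap_comp x P Pₓ hx]
  exact map_unif_eq_classifyingMap_of_isAdmissibleAt hδ 𝓜 Sc ιc unif u rep pts rep_spec pts_unif junction hg hN hcol unif_surj Pₓ h c W hW hclass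

include rep_spec pts_unif junction in
/-- **(B2) — THE SAME, READ AT A MOVED REPRESENTATIVE `[J, s]` OF THE CLASS** (ED. 3; the sheet line՚s `hε₂` in one call): if moreover a rational mover `q`
carries `J` to `J(Z)` (`q_ℝ⁻¹ J q_ℝ = J(Z)`) and `s·K_δ(N)` to `r·K_δ(N)` (`q_𝔸 • rK = sK`) — the `(hJ₂, hq′)` pair exported by the marked Serre-tensor fibre
(DEAL #42) with `J := C.J v`, `s := C.b a · ũ_V(1, z)` — then the complex point `x ≫ φ` has shadow `[J, s·K_δ(N)]`.
[cite: Milne2005ShimuraVarieties, §5 Lemma 5.13 p. 57, §6 Thm. 6.11 pp. 74–75] [cite: MumfordFogartyKirwan1994, Ch. 7 §2 Definitions 7.2–7.3 (p. 129)] -/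
theorem pts_comp_classifyingMap_eq_mk_of_mover (hg : 0 < g) (hN : 3 ≤ N)
    (hcol : IsColimit (Cofan.mk ((Literature.AlgebraicGeometry.Motives.baseChange ℚ ℂ).obj 𝓜.M) ιc))
    (unif_surj : ∀ c, Set.SurjOn (unif c) (siegelUpperHalfSpace g) Set.univ)
    {T : SchemeOver ℚ} [IsLocallyNoetherian T.left] (P : PolarizedAbelianSchemeWithLevel g N δ T.left) (x : specOver ℚ ℂ ⟶ T)
    (Pₓ : PolarizedAbelianSchemeWithLevel g N δ (specOver ℚ ℂ).left) {G : Pₓ.A.X.left ⟶ P.A.X.left} {Ĝ : Pₓ.D.hat.X.left ⟶ P.D.hat.X.left}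
    (hx : Pₓ.IsBaseChangeVia P x.left G Ĝ)
    {Z : Matrix (Fin g) (Fin g) ℂ} {hZ : Z ∈ siegelUpperHalfSpace g} {r : ↥(gspFinAdelic δ)} (h : IsAdmissibleAt hδ r Z hZ Pₓ)
    (q : ↥(gspRational δ)) (J : C0pm δ) (s : ↥(gspFinAdelic δ))
    (hJ : conjJ (((gspRationalToReal δ q)⁻¹ : ↥(gspReal δ)) : GL (Fin g ⊕ Fin g) ℝ) (J : Matrix (Fin g ⊕ Fin g) (Fin g ⊕ Fin g) ℝ) = jOfSiegel δ Z)
    (hq : gspRationalToFinAdelic δ q • ((r : ↥(gspFinAdelic δ)) : ↥(gspFinAdelic δ) ⧸ principalLevelSubgroup δ N) =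
      ((s : ↥(gspFinAdelic δ)) : ↥(gspFinAdelic δ) ⧸ principalLevelSubgroup δ N)) :
    pts (AlgPoints.baseChangeEquiv (algebraMap ℚ ℂ) 𝓜.M (x ≫ 𝓜.classifyingMap T P)) = SiegelShimuraSet.mk δ (principalLevelSubgroup δ N) J s := by
  rw [pts_comp_classifyingMap_eq_mk_of_isAdmissibleAt hδ 𝓜 Sc ιc unif u rep pts rep_spec pts_unif junction hg hN hcol unif_surj P x Pₓ hx h]
  -- `[J(Z), r] = [q_ℝ⁻¹ J q_ℝ, q_𝔸⁻¹ (q_𝔸 r)] = [J, q_𝔸 r] = [J, s]`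
  rw [MulAction.Quotient.smul_mk, smul_eq_mul, QuotientGroup.eq] at hq
  have hJ' : conjAct δ (gspRationalToReal δ q⁻¹) J = ⟨jOfSiegel δ Z, SiegelComplexRecordSystem.jOfSiegel_mem_C0pm hδ.1 hZ⟩ :=
    Subtype.ext (by rw [coe_conjAct, map_inv, hJ])
  have e1 : SiegelShimuraSet.mk δ (principalLevelSubgroup δ N) J s =
      SiegelShimuraSet.mk δ (principalLevelSubgroup δ N) J ((gspRationalToFinAdelic δ q : ↥(gspFinAdelic δ)) * r) := by
    have hs : s = (gspRationalToFinAdelic δ q : ↥(gspFinAdelic δ)) * r * (((gspRationalToFinAdelic δ q : ↥(gspFinAdelic δ)) * r)⁻¹ * s) := by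
      group
    rw [hs, SiegelShimuraSet.mk_mul_of_mem δ (principalLevelSubgroup δ N) J _ hq]
  rw [e1, ← hJ', ← SiegelShimuraSet.mk_conjAct_smul δ (principalLevelSubgroup δ N) q⁻¹ J
    ((gspRationalToFinAdelic δ q : ↥(gspFinAdelic δ)) * r)]
  congr 1
  rw [map_inv, inv_mul_cancel_left]

end AtPoint

end SiegelFineModuliScheme

end Literature.AlgebraicGeometry.ModuliOfAbelianVarieties

end
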